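/-
Copyright (c) 2026 the pub-hodgecm-mathlib formalisation cell (harness21).  Prover seat hodgecm-mathlib-K2E3-p20 (g4), HCML Track B «K2-LIT» (build stream 29),
h413 = `stmt-HodgeConjecture-24833`, line `K2_E3_EllipticInputs`, unit U12 «Characters», socket #11 road (11-SC), letter (SC-an), road HC-14-ell brick (E4-fin)
((SC-an) line lead K2E3-p14 (g3) RULINGS #11 (R11-3) ∕ #13 (R13-1), `K2/STATUS.md` 2026-09-04T03:14:57Z ∕ 03:19:59Z): FINITELY MANY `U(σ, Φ₂)`-CONJUGACY CLASSES OF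
COMPACT CARTAN SUBALGEBRAS OF `𝔲(σ, Φ₂)(K)` — every elliptic regular `X` is `U`-conjugate to `a·1 + b·Y_{r,c}` for a representative `Y_{r,c}` indexed by two square
classes of the fixed field.  2026-09-04.
-/
import Literature.NumberTheory.Automorphic.UnitaryTwoTorusStandardPosition    -- ★ `exists_gl_conj_eq_of_trace_eq_of_det_eq` (GL₂(F)-conjugacy by trace and determinant); brings the `ι : F →+* K`, `σ` frame of the U(1,1) files
import Literature.NumberTheory.Automorphic.UnitaryTwoTreeActionDescent        -- ★ `exists_mem_unitaryGroupOfForm_conj_eq_smul_map` (a determinant-one `F`-conjugator LIFTS to `U(σ, Φ₂)`)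
import Literature.NumberTheory.Automorphic.LocalUnitaryGroupCongr              -- ★ `antidiagOne_eq_over` (`Φ₂` literal = `(StdForm.antidiagonal 2).over K`); brings ★ `unitaryGroupOfForm`, `StdForm`
import Mathlib.RingTheory.Polynomial.Resultant.Basic                           -- Mathlib `Polynomial.discr_of_degree_eq_two`
import Mathlib.LinearAlgebra.Matrix.Charpoly.Coeff                             -- Mathlib `Matrix.charpoly_fin_two`
import HarnessLib

/-!
# h413 ∕ Track B «K2-LIT», (SC-an) line, road HC-14-ell, brick (E4-fin): THE COMPACT CARTAN SUBALGEBRAS OF `𝔲(σ, Φ₂)(K)` UP TO `U(σ, Φ₂)`-CONJUGACY —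
# every elliptic regular `X` is conjugate to `a·1 + b·Y_{r,c}`, `Y_{r,c} = (0, (r∕c)α; c α⁻¹, 0)`, `r`, `c` square-class representatives of the fixed field
# (Serre, *Trees* II §1.2; Labesse–Langlands 1979 §2; Rogawski 1990 §3.6; O'Meara 63:9)

Cell `pub/hodgecm-mathlib`, crux H413 = `stmt-HodgeConjecture-24833`, route of record `HCCMUnconditional`; chair K2-lead (g0), dealer K2E3-plan (g2), (SC-an) line lead
K2E3-p14 (g3).  THEOREMS ONLY (no `def`, no `instance`, no `notation`, no named-fact hypothesis, no `sorry`); lane `--supports stmt-HodgeConjecture-24833 --as helper`,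
count-neutral.  RULING #11 (R11-3) «(E4-fin) finitely many `U(J₂)`-conjugacy classes of compact Cartan subalgebras of `𝔲(σ,J₂)` … head: `∃ n (Y : Fin n → M₂ K), (∀ i, Y i ∈ 𝔲 ∧
elliptic regular) ∧ ∀ X ∈ 𝔲, discr χ_X ≠ 0 → elliptic → ∃ i (g : U) (a b : K), ↑g X ↑g⁻¹ = a • 1 + b • Y i` (`a` skew, `b` σ-fixed)»; the consumer is K2E5-p15 (g3)'s
file (C) `K2E3HC14EllBaseCaseU2` (E4 per Cartan; (E4-fin) moves an arbitrary elliptic regular `X` into one of finitely many Cartans).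

THE FRAME (of the ★ `U(1,1)` files `UnitaryTwoTorusStandardPosition`, `UnitaryTwoTreeActionDescent`): `ι : F →+* K`, an involution `σ` of `K` fixing exactly `ι(F)`
(`hσ`, `hσι`, `hfix`), an anti-fixed unit `α`, `2 ≠ 0`; `Φ₂ = (0 1; 1 0) = (StdForm.antidiagonal 2).over K`; `𝔲 = {X : (X.map σ)ᵀ Φ₂ + Φ₂ X = 0}` (K2E5-p15 (g3)'s currency).
«ELLIPTIC» is taken as (E-iso) «no isotropic eigenvector» `∀ v ≠ 0, (∃ μ, X v = μ v) → σ(v₀)v₁ + σ(v₁)v₀ ≠ 0` (the form the consumer's proof uses; `IsCompact Z_U(X)` implies it —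
a split torus sits in the centraliser of an isotropic eigen-line — that topological bridge is left to the place-level assembly).  FINITENESS INPUT = a finite set `R ⊆ F` of
representatives of `F^× ∕ F^{×2}` (binder `hR`; at `F = L⁺_v` ★ `QuadraticForms.SquareClassIndex.index_square_eq_four_mul_natCard`, O'Meara 63:9).

THE MATHEMATICS.  `X ∈ 𝔲` ⇒ `X = a·1 + Z`, `a = (X₀₀ − σX₀₀)∕2` skew, `Z = (x, b; c, −x)`, `δ = x² + bc` fixed, `Z² = δ·1`, `discr χ_X = 4δ`; DESCENT `diag(1,α) Z diag(1,α)⁻¹ = ι(W)`,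
`W ∈ 𝔰𝔩₂(F)`, `ι(−det W) = δ`; a square `δ = e²` gives the ISOTROPIC eigenvector `(b, e − x)`, so (E-iso) forces `−det W = r e²` with `r ∈ R` NON-square; `W` and `(0, e r; e, 0)`
are `GL₂(F)`-conjugate (★ cyclic vectors, equal trace∕det), the conjugator is rescaled to determinant ONE at the price of the twist `c ∈ R` of its determinant's square class,
and determinant-one conjugators LIFT to `U(σ, Φ₂)` (★), giving `u X u⁻¹ = a·1 + ι(e)·Y_{r,c}` [Serre1980Trees II §1.2; LabesseLanglands1979 §2; Rogawski1990 §3.6 (`SU(1,1) ≅ SL₂`)].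

* §0 `mem_lieU_two_iff` (entrywise membership in `𝔲(σ, Φ₂)`).
* §1 `map_half_sub_eq_neg`, `map_half_add_eq`, `eq_smul_one_add_traceless` (`X = a·1 + Z`), `discr_charpoly_eq_four_mul` (`discr χ_X = 4δ`).
* §2 `exists_isotropic_eigenvector_of_delta_eq_sq` (a square `δ` gives an isotropic eigen-line) and `not_isotropic_eigenvector_rep` ((E-iso) for `Y_{r,c}`).
* §3 `exists_descent_traceless` (`diag(1,α) Z diag(1,α)⁻¹ = ι(W)`), `exists_gl_det_one_conj_eq_rep` (the determinant-one `F`-conjugator into `V_c`),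
  **`exists_unitary_conj_eq_normalForm`** (one `X`: `∃ r c ∈ R, ∃ u ∈ U, ∃ a b, σa = −a ∧ σb = b ∧ u X u⁻¹ = a·1 + b·Y_{r,c}`).
* §4 HEAD **`exists_fin_compactCartan_representatives`** — the letter's shape: `∃ n (Y : Fin n → M₂ K), (∀ i, Y i ∈ 𝔲 ∧ discr χ_{Y i} ≠ 0 ∧ (E-iso)(Y i)) ∧ ∀ X ∈ 𝔲, discr χ_X ≠ 0 →
  (E-iso)(X) → ∃ i (g : ↥U) (a b : K), σa = −a ∧ σb = b ∧ ↑g X ↑g⁻¹ = a • 1 + b • Y i`, for `J` with `hJ : J = (StdForm.antidiagonal 2).over K`.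

HONEST LABEL.  HC_CM is proved only modulo the 7 printed citations (2 remaining named inputs: hLiu418 = `stmt-HodgeConjecture-24832`, h413 = `stmt-HodgeConjecture-24833`)
until rung 0 closes; count-neutral helper (linear algebra for the HC-14-ell assembly; nothing printed is asserted as a fact).

## References
* [Serre1980Trees] J.-P. Serre, *Trees* (1980), Ch. II §1.2–§1.3 · [LabesseLanglands1979] J.-P. Labesse, R. P. Langlands, *L-indistinguishability for SL(2)*, Canad. J. Math. 31
  (1979), §2 p. 7 · [Rogawski1990] J. D. Rogawski, *Automorphic Representations of Unitary Groups in Three Variables* (1990), §3.6 p. 31 · [Omeara1963] O. T. O'Meara,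
  *Introduction to Quadratic Forms* (1963), 63:9.
-/

set_option autoImplicit false
set_option linter.dupNamespace false  -- the mandated namespace repeats the single-problem summit's segment (`HodgeConjecture.HodgeConjecture`)

noncomputable section

open Matrix Polynomial
open scoped MatrixGroups
open Literature.NumberTheory.Automorphic Literature.NumberTheory.Automorphic.UnitaryGroup

namespace Summit.HodgeConjecture.HodgeConjecture.Cruxes.H413.K2E3U2CompactCartanClasses

/-! ## §0 The form `Φ₂` and entrywise membership in `𝔲(σ, Φ₂)` -/

section Algebra

variable {F K : Type*} [Field F] [Field K] (ι : F →+* K) (σ : K →+* K) (hσ : ∀ x, σ (σ x) = x) (hσι : ∀ x : F, σ (ι x) = ι x)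
  (hfix : ∀ z : K, σ z = z → ∃ x : F, ι x = z) {α : K} (hα : σ α = -α) (hα0 : α ≠ 0) (h2 : (2 : K) ≠ 0)

include hσ in
/-- **Membership in `𝔲(σ, Φ₂)` entrywise**: `(X.map σ)ᵀ Φ₂ + Φ₂ X = 0` iff `X₁₀`, `X₀₁` are skew and `X₁₁ = −σ X₀₀`. [cite: Rogawski1990, §3.6 p. 31] -/
theorem mem_lieU_two_iff (X : Matrix (Fin 2) (Fin 2) K) :
    (X.map σ)ᵀ * !![(0 : K), 1; 1, 0] + !![(0 : K), 1; 1, 0] * X = 0 ↔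
      σ (X 1 0) = -X 1 0 ∧ σ (X 0 1) = -X 0 1 ∧ X 1 1 = -σ (X 0 0) := by
  rw [← Matrix.ext_iff]
  simp only [Fin.forall_fin_two, Matrix.add_apply, Matrix.mul_apply, Fin.sum_univ_two, Matrix.transpose_apply, Matrix.map_apply, Matrix.zero_apply,
    Matrix.of_apply, Matrix.cons_val', Matrix.cons_val_zero, Matrix.cons_val_one, Matrix.empty_val', Matrix.cons_val_fin_one]
  constructor
  · rintro ⟨⟨h00, h01⟩, h10, h11⟩
    refine ⟨?_, ?_, ?_⟩
    · linear_combination h00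
    · linear_combination h11
    · linear_combination h01
  · rintro ⟨h1, h2', h3⟩
    have h4 : σ (X 1 1) = -X 0 0 := by rw [h3, map_neg, hσ]
    refine ⟨⟨?_, ?_⟩, ?_, ?_⟩
    · linear_combination h1
    · linear_combination h3
    · linear_combination h4
    · linear_combination h2'

/-! ## §1 The invariants `a` (skew centre part), `x`, `δ = x² + bc`; `X = a·1 + Z`, `Z² = δ·1`, `discr χ_X = 4δ` -/

include hσ in
/-- `σ((p − σp)∕2) = −(p − σp)∕2`. [folklore] -/
theorem map_half_sub_eq_neg (p : K) : σ ((p - σ p) / 2) = -((p - σ p) / 2) := by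
  rw [map_div₀, map_sub, hσ, map_ofNat]; ring

include hσ in
/-- `σ((p + σp)∕2) = (p + σp)∕2`. [folklore] -/
theorem map_half_add_eq (p : K) : σ ((p + σ p) / 2) = (p + σ p) / 2 := by
  rw [map_div₀, map_add, hσ, map_ofNat, add_comm]

include hσ h2 in
/-- **`X = a·1 + Z`** with `a = (X₀₀ − σX₀₀)∕2` and `Z = (x, X₀₁; X₁₀, −x)`, `x = (X₀₀ + σX₀₀)∕2`, for `X ∈ 𝔲(σ, Φ₂)`. [cite: Rogawski1990, §3.6 p. 31] -/
theorem eq_smul_one_add_traceless {X : Matrix (Fin 2) (Fin 2) K} (hX : (X.map σ)ᵀ * !![(0 : K), 1; 1, 0] + !![(0 : K), 1; 1, 0] * X = 0) :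
    X = ((X 0 0 - σ (X 0 0)) / 2) • (1 : Matrix (Fin 2) (Fin 2) K) +
      !![(X 0 0 + σ (X 0 0)) / 2, X 0 1; X 1 0, -((X 0 0 + σ (X 0 0)) / 2)] := by
  obtain ⟨-, -, h3⟩ := (mem_lieU_two_iff σ hσ X).1 hX
  ext i j
  fin_cases i <;> fin_cases j
  · simp
    field_simp
    ring
  · simp [Matrix.one_apply_ne]
  · simp [Matrix.one_apply_ne]
  · simp [h3]
    field_simp
    ring

include hσ h2 in
/-- **`discr χ_X = 4δ`**, `δ = x² + X₀₁X₁₀`, for `X ∈ 𝔲(σ, Φ₂)` (`tr X = 2a`, `det X = a² − δ`; Mathlib `Matrix.charpoly_fin_two`, `Polynomial.discr_of_degree_eq_two`).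
[cite: Serre1980Trees, Ch. II §1.2] -/
theorem discr_charpoly_eq_four_mul {X : Matrix (Fin 2) (Fin 2) K} (hX : (X.map σ)ᵀ * !![(0 : K), 1; 1, 0] + !![(0 : K), 1; 1, 0] * X = 0) :
    X.charpoly.discr = 4 * (((X 0 0 + σ (X 0 0)) / 2) ^ 2 + X 0 1 * X 1 0) := by
  obtain ⟨-, -, h3⟩ := (mem_lieU_two_iff σ hσ X).1 hX
  have hdeg : X.charpoly.degree = 2 := by rw [Matrix.charpoly_degree_eq_dim]; rfl
  rw [Polynomial.discr_of_degree_eq_two hdeg, Matrix.charpoly_fin_two]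
  simp only [Matrix.trace_fin_two, Matrix.det_fin_two, coeff_add, coeff_sub, coeff_X_pow, coeff_C_mul, coeff_X, coeff_C, h3]
  norm_num
  field_simp
  ring

/-! ## §2 Eigen-lines: a square `δ` gives an ISOTROPIC eigenvector; the representatives `Y_{r,c}` have none -/

include hσ h2 in
/-- **A SQUARE `δ` GIVES AN ISOTROPIC EIGEN-LINE**: if `X ∈ 𝔲(σ,Φ₂)` has `δ = x² + X₀₁X₁₀ = e²` with `σ e = e`, then `X` has a non-zero eigenvector `v` with `σ(v₀)v₁ + σ(v₁)v₀ = 0`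
(`v = (X₀₁, e − x)` when `X₀₁ ≠ 0`, else `v = (0, 1)`) — so «no isotropic eigenvector» forces `δ ∉ (Fix σ)²`. [cite: Rogawski1990, §3.6 p. 31] [cite: Serre1980Trees, Ch. II §1.2] -/
theorem exists_isotropic_eigenvector_of_delta_eq_sq {X : Matrix (Fin 2) (Fin 2) K} (hX : (X.map σ)ᵀ * !![(0 : K), 1; 1, 0] + !![(0 : K), 1; 1, 0] * X = 0)
    {e : K} (he : σ e = e) (hδ : ((X 0 0 + σ (X 0 0)) / 2) ^ 2 + X 0 1 * X 1 0 = e ^ 2) :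
    ∃ v : Fin 2 → K, v ≠ 0 ∧ (∃ μ : K, X.mulVec v = μ • v) ∧ σ (v 0) * v 1 + σ (v 1) * v 0 = 0 := by
  obtain ⟨-, hb, h3⟩ := (mem_lieU_two_iff σ hσ X).1 hX
  have hxσ : σ ((X 0 0 + σ (X 0 0)) / 2) = (X 0 0 + σ (X 0 0)) / 2 := map_half_add_eq σ hσ (X 0 0)
  have hx2 : 2 * ((X 0 0 + σ (X 0 0)) / 2) = X 0 0 + σ (X 0 0) := by field_simp
  generalize hx : (X 0 0 + σ (X 0 0)) / 2 = x at hδ hxσ hx2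
  have h11 : X 1 1 = X 0 0 - 2 * x := by rw [h3]; linear_combination hx2
  by_cases hb0 : X 0 1 = 0
  · refine ⟨![0, 1], ?_, ⟨X 1 1, ?_⟩, by simp⟩
    · intro h; have := congr_fun h 1; simp at this
    · ext i
      fin_cases i <;> simp [Matrix.mulVec, dotProduct, Fin.sum_univ_two, hb0]
  · refine ⟨![X 0 1, e - x], ?_, ⟨X 0 0 - x + e, ?_⟩, ?_⟩
    · intro h; have := congr_fun h 0; simp at this; exact hb0 this
    · ext i
      fin_cases i
      · simp [Matrix.mulVec, dotProduct, Fin.sum_univ_two]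
        ring
      · simp [Matrix.mulVec, dotProduct, Fin.sum_univ_two, h11]
        linear_combination hδ
    · simp only [Matrix.cons_val_zero, Matrix.cons_val_one, map_sub, hb, he, hxσ]
      ring

include hσ hσι hα in
/-- The representative `Y_{r,c} = (0, ι(r∕c)·α; ι(c)·α⁻¹, 0)` lies in `𝔲(σ, Φ₂)` (its off-diagonal entries are skew). [cite: Rogawski1990, §3.6 p. 31] -/
theorem rep_mem_lieU (r c : F) :
    ((!![(0 : K), ι (r / c) * α; ι c * α⁻¹, 0]).map σ)ᵀ * !![(0 : K), 1; 1, 0] + !![(0 : K), 1; 1, 0] * !![(0 : K), ι (r / c) * α; ι c * α⁻¹, 0] = 0 := by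
  rw [mem_lieU_two_iff σ hσ]
  simp [hσι, hα, map_inv₀]

include σ hσ hσι hα hα0 h2 in
/-- `discr χ_{Y_{r,c}} = 4·ι(r)` (`δ(Y_{r,c}) = ι(r∕c)·α·ι(c)·α⁻¹ = ι r`). [cite: Serre1980Trees, Ch. II §1.2] -/
theorem discr_charpoly_rep (r : F) {c : F} (hc : c ≠ 0) :
    (!![(0 : K), ι (r / c) * α; ι c * α⁻¹, 0]).charpoly.discr = 4 * ι r := by
  rw [discr_charpoly_eq_four_mul σ hσ h2 (rep_mem_lieU ι σ hσ hσι hα r c)]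
  have hιc : ι c ≠ 0 := (map_ne_zero ι).2 hc
  simp only [Matrix.of_apply, Matrix.cons_val', Matrix.cons_val_zero, Matrix.cons_val_one, Matrix.empty_val', Matrix.cons_val_fin_one, map_zero, add_zero,
    zero_div, map_div₀]
  field_simp
  ring

include hσι hfix hα hα0 in
/-- **THE REPRESENTATIVES HAVE NO ISOTROPIC EIGEN-LINE** when `r` is not a square in `F`: an isotropic eigenvector `v` of `Y_{r,c}` would have a `σ`-fixed eigenvalue
`μ = ι(c)α⁻¹v₀∕v₁` (isotropy reads `σ(v₀∕v₁) = −v₀∕v₁`), hence `μ = ι f` and `ι r = μ² = ι(f²)`. [cite: Rogawski1990, §3.6 p. 31] [cite: LabesseLanglands1979, §2 p. 7] -/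
theorem not_isotropic_eigenvector_rep {r : F} (hr : ∀ f : F, r ≠ f ^ 2) {c : F} (hc : c ≠ 0)
    (v : Fin 2 → K) (hv : v ≠ 0) (hμ : ∃ μ : K, (!![(0 : K), ι (r / c) * α; ι c * α⁻¹, 0]).mulVec v = μ • v) :
    σ (v 0) * v 1 + σ (v 1) * v 0 ≠ 0 := by
  obtain ⟨μ, hμ⟩ := hμ
  have hr0 : r ≠ 0 := fun h => hr 0 (by rw [h]; ring)
  have hιc : ι c ≠ 0 := (map_ne_zero ι).2 hc
  have hιr : ι r ≠ 0 := (map_ne_zero ι).2 hr0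
  have e0 : ι (r / c) * α * v 1 = μ * v 0 := by
    have := congr_fun hμ 0; simpa [Matrix.mulVec, dotProduct, Fin.sum_univ_two] using this
  have e1 : ι c * α⁻¹ * v 0 = μ * v 1 := by
    have := congr_fun hμ 1; simpa [Matrix.mulVec, dotProduct, Fin.sum_univ_two] using this
  have hv1 : v 1 ≠ 0 := by
    intro h1
    have hv0 : v 0 ≠ 0 := by
      intro h0; apply hv; ext i; fin_cases i <;> simp [h0, h1]
    have hμ0 : μ = 0 := by
      have := e0; rw [h1, mul_zero] at this; exact (mul_eq_zero.1 this.symm).resolve_right hv0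
    rw [h1, hμ0, mul_zero] at e1
    exact hv0 ((mul_eq_zero.1 e1).resolve_left (mul_ne_zero hιc (inv_ne_zero hα0)))
  have hv0 : v 0 ≠ 0 := by
    intro h0
    have hμ0 : μ = 0 := by
      have := e1; rw [h0, mul_zero] at this; exact (mul_eq_zero.1 this.symm).resolve_right hv1
    rw [h0, hμ0, mul_zero] at e0
    have : ι (r / c) * α = 0 := (mul_eq_zero.1 e0).resolve_right hv1
    exact (mul_ne_zero (by rw [map_div₀]; exact div_ne_zero hιr hιc) hα0) this
  -- `μ² = ι r`
  have hμsq : μ ^ 2 = ι r := by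
    have h : μ ^ 2 * (v 0 * v 1) = ι r * (v 0 * v 1) := by
      calc μ ^ 2 * (v 0 * v 1) = (μ * v 0) * (μ * v 1) := by ring
        _ = (ι (r / c) * α * v 1) * (ι c * α⁻¹ * v 0) := by rw [e0, e1]
        _ = ι r * (v 0 * v 1) := by rw [map_div₀]; field_simp
    exact mul_right_cancel₀ (mul_ne_zero hv0 hv1) h
  intro hiso
  -- isotropy makes `μ` σ-fixed
  have hσμ : σ μ = μ := by
    have hμ' : μ = ι c * α⁻¹ * v 0 / v 1 := by rw [eq_div_iff hv1, e1]
    have hσv1 : σ (v 1) ≠ 0 := (map_ne_zero σ).2 hv1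
    have hiso' : σ (v 0) = -(σ (v 1) * v 0) / v 1 := by rw [eq_div_iff hv1]; linear_combination hiso
    rw [hμ', map_div₀, map_mul, map_mul, map_inv₀, hσι, hα, hiso']
    field_simp
  obtain ⟨f, hf⟩ := hfix μ hσμ
  apply hr f
  apply ι.injective
  rw [map_pow, hf, hμsq]

/-! ## §3 Descent to `𝔰𝔩₂(F)` and the determinant-one conjugator into the normal form -/

include hσ hfix hα hα0 in
/-- **DESCENT OF THE TRACELESS PART** (the Lie twin of ★ `descent_of_mem_unitaryGroupOfForm_antidiag`): for `X ∈ 𝔲(σ,Φ₂)`,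
`diag(1,α)·Z·diag(1,α⁻¹) = ι(W)` for a traceless `W ∈ M₂(F)` with `ι(−det W) = δ`. [cite: LabesseLanglands1979, §2 p. 7] [cite: Rogawski1990, §3.6 p. 31] -/
theorem exists_descent_traceless {X : Matrix (Fin 2) (Fin 2) K} (hX : (X.map σ)ᵀ * !![(0 : K), 1; 1, 0] + !![(0 : K), 1; 1, 0] * X = 0) :
    ∃ W : Matrix (Fin 2) (Fin 2) F, W.trace = 0 ∧ ι (-W.det) = ((X 0 0 + σ (X 0 0)) / 2) ^ 2 + X 0 1 * X 1 0 ∧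
      Matrix.diagonal ![(1 : K), α] * !![(X 0 0 + σ (X 0 0)) / 2, X 0 1; X 1 0, -((X 0 0 + σ (X 0 0)) / 2)] * Matrix.diagonal ![(1 : K), α⁻¹] =
        W.map ι := by
  obtain ⟨hc, hb, -⟩ := (mem_lieU_two_iff σ hσ X).1 hX
  obtain ⟨x', hx'⟩ := hfix ((X 0 0 + σ (X 0 0)) / 2) (map_half_add_eq σ hσ (X 0 0))
  obtain ⟨b', hb'⟩ := hfix (X 0 1 * α⁻¹) (by rw [map_mul, map_inv₀, hb, hα]; field_simp)
  obtain ⟨c', hc'⟩ := hfix (α * X 1 0) (by rw [map_mul, hc, hα]; ring)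
  refine ⟨!![x', b'; c', -x'], by simp [Matrix.trace_fin_two], ?_, ?_⟩
  · rw [Matrix.det_fin_two_of, map_neg, map_sub, map_mul, map_mul, map_neg, hx', hb', hc']
    field_simp
    ring
  · ext i j
    fin_cases i <;> fin_cases j
    · simp [Matrix.diagonal, Matrix.mul_apply, hx']
    · simp [Matrix.diagonal, Matrix.mul_apply, hb']
    · simp [Matrix.diagonal, Matrix.mul_apply, hc']
    · simp [Matrix.diagonal, Matrix.mul_apply, hx', map_neg]
      field_simp

include hσ hσι hfix hα hα0 h2 in
/-- **NORMAL FORM OF ONE ELLIPTIC REGULAR ELEMENT.**  Let `R ⊆ F` represent the square classes of `F^×` (`hR`).  If `X ∈ 𝔲(σ, Φ₂)` is regular (`discr χ_X ≠ 0`) and has NO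
isotropic eigen-line, then for some non-square `r ∈ R`, some `c ∈ R` and some `u ∈ U(σ, Φ₂)`: `u X u⁻¹ = a·1 + b·Y_{r,c}` with `a` skew, `b` fixed, `Y_{r,c} = (0, ι(r∕c)α; ι(c)α⁻¹, 0)`
— descent to `𝔰𝔩₂(F)`, ★ `GL₂(F)`-conjugacy by trace∕determinant, rescaling to determinant one at the price of the twist `c`, ★ lift of determinant-one conjugators.
[cite: Serre1980Trees, Ch. II §1.2] [cite: LabesseLanglands1979, §2 p. 7] [cite: Rogawski1990, §3.6 p. 31] -/
theorem exists_unitary_conj_eq_normalForm (R : Finset F) (hR : ∀ d : F, d ≠ 0 → ∃ r ∈ R, ∃ f : F, f ≠ 0 ∧ d = r * f ^ 2)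
    {X : Matrix (Fin 2) (Fin 2) K} (hX : (X.map σ)ᵀ * !![(0 : K), 1; 1, 0] + !![(0 : K), 1; 1, 0] * X = 0) (hreg : X.charpoly.discr ≠ 0)
    (hell : ∀ v : Fin 2 → K, v ≠ 0 → (∃ μ : K, X.mulVec v = μ • v) → σ (v 0) * v 1 + σ (v 1) * v 0 ≠ 0) :
    ∃ r ∈ R, ∃ c ∈ R, (∀ f : F, r ≠ f ^ 2) ∧ c ≠ 0 ∧ ∃ u : ↥(unitaryGroupOfForm σ !![(0 : K), 1; 1, 0]), ∃ a b : K, σ a = -a ∧ σ b = b ∧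
      ((u : GL (Fin 2) K) : Matrix (Fin 2) (Fin 2) K) * X * (((u : GL (Fin 2) K) : Matrix (Fin 2) (Fin 2) K))⁻¹ =
        a • (1 : Matrix (Fin 2) (Fin 2) K) + b • !![(0 : K), ι (r / c) * α; ι c * α⁻¹, 0] := by
  have hXdec := eq_smul_one_add_traceless σ hσ h2 hX
  obtain ⟨W, hWtr, hWdet, hWeq⟩ := exists_descent_traceless ι σ hσ hfix hα hα0 hX
  have hδ : ((X 0 0 + σ (X 0 0)) / 2) ^ 2 + X 0 1 * X 1 0 ≠ 0 := by
    intro h0; apply hreg; rw [discr_charpoly_eq_four_mul σ hσ h2 hX, h0, mul_zero]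
  have hd0 : -W.det ≠ 0 := fun h => hδ (by rw [← hWdet, h, map_zero])
  obtain ⟨r, hrR, e, he0, hde⟩ := hR (-W.det) hd0
  -- `r` is not a square: otherwise `δ = ι(f e)²` produces an isotropic eigen-line
  have hr : ∀ f : F, r ≠ f ^ 2 := by
    intro f hf
    have hsq : ((X 0 0 + σ (X 0 0)) / 2) ^ 2 + X 0 1 * X 1 0 = (ι (f * e)) ^ 2 := by
      rw [← hWdet, hde, hf, ← map_pow]; congr 1; ring
    obtain ⟨v, hv, hμ, hiso⟩ := exists_isotropic_eigenvector_of_delta_eq_sq σ hσ h2 hX (hσι (f * e)) hsq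
    exact hell v hv hμ hiso
  have hr0 : r ≠ 0 := fun h => hr 0 (by rw [h]; ring)
  have h2F : (2 : F) ≠ 0 := fun h => h2 (by rw [← map_ofNat ι 2, h, map_zero])
  -- `W` and `V₁ = (0, e r; e, 0)` are non-scalar with equal trace and determinant
  have hWns : ∀ m : F, W ≠ m • (1 : Matrix (Fin 2) (Fin 2) F) := by
    intro m hm
    have htr : W.trace = 2 * m := by rw [hm, Matrix.trace_smul, Matrix.trace_one]; simp; ring
    have hm0 : m = 0 := by rw [hWtr] at htr; exact (mul_eq_zero.1 htr.symm).resolve_left h2F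
    apply hd0
    rw [hm, hm0, zero_smul, Matrix.det_zero, neg_zero]
  have hV1ns : ∀ m : F, !![(0 : F), e * r; e, 0] ≠ m • (1 : Matrix (Fin 2) (Fin 2) F) := by
    intro m hm
    have := congr_fun (congr_fun hm 1) 0
    simp at this
    exact he0 this
  obtain ⟨h, hh⟩ := exists_gl_conj_eq_of_trace_eq_of_det_eq W !![(0 : F), e * r; e, 0] hWns hV1ns
    (by rw [hWtr, Matrix.trace_fin_two_of]; ring) (by rw [Matrix.det_fin_two_of]; linear_combination (-1 : F) * hde)
  have hhdet : ((h : GL (Fin 2) F) : Matrix (Fin 2) (Fin 2) F).det ≠ 0 := (Matrix.isUnits_det_units h).ne_zero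
  have hhW : ((h : GL (Fin 2) F) : Matrix (Fin 2) (Fin 2) F) * W = !![(0 : F), e * r; e, 0] * ((h : GL (Fin 2) F) : Matrix (Fin 2) (Fin 2) F) := by
    have := congrArg (· * ((h : GL (Fin 2) F) : Matrix (Fin 2) (Fin 2) F)) hh
    simpa only [Matrix.mul_assoc, ← Units.val_mul, inv_mul_cancel, Units.val_one, Matrix.mul_one] using this
  -- `det h = c f²`; `h′ = (c f)⁻¹ · diag(1,c) · h` has determinant one and lifts to `u ∈ U(σ, Φ₂)`
  obtain ⟨c, hcR, f, hf0, hdet⟩ := hR _ hhdet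
  have hc0 : c ≠ 0 := by rintro rfl; exact hhdet (by rw [hdet, zero_mul])
  set h' : Matrix (Fin 2) (Fin 2) F := (c * f)⁻¹ • (Matrix.diagonal ![(1 : F), c] * ((h : GL (Fin 2) F) : Matrix (Fin 2) (Fin 2) F)) with hh'
  have hh'det : h'.det = 1 := by
    rw [hh', Matrix.det_smul, Matrix.det_mul, Matrix.det_diagonal, hdet]
    simp [Fin.prod_univ_two]
    field_simp
  have hdiagV : Matrix.diagonal ![(1 : F), c] * !![(0 : F), e * r; e, 0] = !![(0 : F), e * r / c; e * c, 0] * Matrix.diagonal ![(1 : F), c] := by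
    ext i j
    fin_cases i <;> fin_cases j <;> simp [Matrix.mul_apply, Matrix.diagonal]
    · field_simp
    · ring
  have hh'W : h' * W = !![(0 : F), e * r / c; e * c, 0] * h' := by
    rw [hh', Matrix.smul_mul, Matrix.mul_smul, Matrix.mul_assoc, hhW, ← Matrix.mul_assoc, hdiagV, Matrix.mul_assoc]
  have hh'U : IsUnit h' := (Matrix.isUnit_iff_isUnit_det h').2 (by rw [hh'det]; exact isUnit_one)
  obtain ⟨u, hu⟩ := exists_mem_unitaryGroupOfForm_conj_eq_smul_map ι σ hσι hα hα0 (s := 1) (g := hh'U.unit)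
    (by rw [IsUnit.unit_spec, hh'det, map_one, map_one, mul_one, mul_one])
  rw [IsUnit.unit_spec, one_smul] at hu
  have hDD' := diagonal_mul_diagonal_inv (E := K) hα0
  have hD'D := diagonal_inv_mul_diagonal (E := K) hα0
  set uM : Matrix (Fin 2) (Fin 2) K := ((u : GL (Fin 2) K) : Matrix (Fin 2) (Fin 2) K) with huM
  have huM' : uM = Matrix.diagonal ![(1 : K), α⁻¹] * h'.map ι * Matrix.diagonal ![(1 : K), α] := by
    rw [← hu, ← Matrix.mul_assoc, ← Matrix.mul_assoc, hD'D, Matrix.one_mul, Matrix.mul_assoc, hD'D, Matrix.mul_one]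
  have hZ : !![(X 0 0 + σ (X 0 0)) / 2, X 0 1; X 1 0, -((X 0 0 + σ (X 0 0)) / 2)] =
      Matrix.diagonal ![(1 : K), α⁻¹] * W.map ι * Matrix.diagonal ![(1 : K), α] := by
    rw [← hWeq, ← Matrix.mul_assoc, ← Matrix.mul_assoc, hD'D, Matrix.one_mul, Matrix.mul_assoc, hD'D, Matrix.mul_one]
  have hY : (ι e) • !![(0 : K), ι (r / c) * α; ι c * α⁻¹, 0] = Matrix.diagonal ![(1 : K), α⁻¹] * (!![(0 : F), e * r / c; e * c, 0]).map ι * Matrix.diagonal ![(1 : K), α] := by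
    ext i j
    fin_cases i <;> fin_cases j <;> simp [Matrix.mul_apply, Matrix.diagonal, map_div₀] <;> ring
  have hmapW : h'.map ι * W.map ι = (!![(0 : F), e * r / c; e * c, 0]).map ι * h'.map ι := by
    rw [← Matrix.map_mul, hh'W, Matrix.map_mul]
  have hcomm : uM * !![(X 0 0 + σ (X 0 0)) / 2, X 0 1; X 1 0, -((X 0 0 + σ (X 0 0)) / 2)] = ((ι e) • !![(0 : K), ι (r / c) * α; ι c * α⁻¹, 0]) * uM := by
    rw [huM', hZ, hY]
    calc Matrix.diagonal ![(1 : K), α⁻¹] * h'.map ι * Matrix.diagonal ![(1 : K), α] *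
          (Matrix.diagonal ![(1 : K), α⁻¹] * W.map ι * Matrix.diagonal ![(1 : K), α])
        = Matrix.diagonal ![(1 : K), α⁻¹] * (h'.map ι * ((Matrix.diagonal ![(1 : K), α] * Matrix.diagonal ![(1 : K), α⁻¹]) * W.map ι)) *
            Matrix.diagonal ![(1 : K), α] := by simp only [Matrix.mul_assoc]
      _ = Matrix.diagonal ![(1 : K), α⁻¹] * ((!![(0 : F), e * r / c; e * c, 0]).map ι * ((Matrix.diagonal ![(1 : K), α] * Matrix.diagonal ![(1 : K), α⁻¹]) * h'.map ι)) *
            Matrix.diagonal ![(1 : K), α] := by rw [hDD', Matrix.one_mul, Matrix.one_mul, hmapW]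
      _ = Matrix.diagonal ![(1 : K), α⁻¹] * (!![(0 : F), e * r / c; e * c, 0]).map ι * Matrix.diagonal ![(1 : K), α] *
            (Matrix.diagonal ![(1 : K), α⁻¹] * h'.map ι * Matrix.diagonal ![(1 : K), α]) := by simp only [Matrix.mul_assoc]
  refine ⟨r, hrR, c, hcR, hr, hc0, u, (X 0 0 - σ (X 0 0)) / 2, ι e, map_half_sub_eq_neg σ hσ (X 0 0), hσι e, ?_⟩
  have huX : uM * X = (((X 0 0 - σ (X 0 0)) / 2) • (1 : Matrix (Fin 2) (Fin 2) K) + (ι e) • !![(0 : K), ι (r / c) * α; ι c * α⁻¹, 0]) * uM := by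
    conv_lhs => rw [hXdec]
    rw [Matrix.mul_add, Matrix.add_mul, Matrix.mul_smul, Matrix.mul_one, Matrix.smul_mul, Matrix.one_mul, hcomm]
  have hdetu : IsUnit uM.det := Matrix.isUnits_det_units (u : GL (Fin 2) K)
  rw [huX, Matrix.mul_nonsing_inv_cancel_right _ _ hdetu]

/-! ## §4 The head: finitely many representatives, in the letter's shape -/

include hσ hσι hfix hα hα0 h2 in
open scoped Classical in
/-- **(E4-fin) FINITELY MANY `U(σ, Φ₂)`-CLASSES OF COMPACT CARTAN SUBALGEBRAS OF `𝔲(σ, Φ₂)(K)`** — the letter's shape (RULING #11 (R11-3)).  Given representatives `R` of the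
square classes of `F^×` (`hR`; finite by O'Meara 63:9, ★ `SquareClassIndex` at a place), there are finitely many `Y₁, …, Yₙ ∈ 𝔲(σ, J)` (`J = Φ₂`), each regular
(`discr χ ≠ 0`) with NO isotropic eigen-line, such that EVERY regular `X ∈ 𝔲(σ, J)` without isotropic eigen-line is `U(σ, J)`-conjugate to `a·1 + b·Y_i` with `a` skew and
`b` fixed.  (The `Y_i` are the `Y_{r,c} = (0, ι(r∕c)α; ι(c)α⁻¹, 0)`, `r ∈ R` non-square, `c ∈ R ∖ {0}`.)
[cite: Serre1980Trees, Ch. II §1.2–§1.3] [cite: LabesseLanglands1979, §2 p. 7] [cite: Rogawski1990, §3.6 p. 31] [cite: Omeara1963, 63:9] -/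
theorem exists_fin_compactCartan_representatives {J : Matrix (Fin 2) (Fin 2) K} (hJ : J = (StdForm.antidiagonal 2).over K)
    (R : Finset F) (hR : ∀ d : F, d ≠ 0 → ∃ r ∈ R, ∃ f : F, f ≠ 0 ∧ d = r * f ^ 2) :
    ∃ (n : ℕ) (Y : Fin n → Matrix (Fin 2) (Fin 2) K),
      (∀ i, ((Y i).map σ)ᵀ * J + J * Y i = 0 ∧ (Y i).charpoly.discr ≠ 0 ∧
        ∀ v : Fin 2 → K, v ≠ 0 → (∃ μ : K, (Y i).mulVec v = μ • v) → σ (v 0) * v 1 + σ (v 1) * v 0 ≠ 0) ∧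
      ∀ X : Matrix (Fin 2) (Fin 2) K, (X.map σ)ᵀ * J + J * X = 0 → X.charpoly.discr ≠ 0 →
        (∀ v : Fin 2 → K, v ≠ 0 → (∃ μ : K, X.mulVec v = μ • v) → σ (v 0) * v 1 + σ (v 1) * v 0 ≠ 0) →
        ∃ (i : Fin n) (g : ↥(unitaryGroupOfForm σ J)) (a b : K), σ a = -a ∧ σ b = b ∧
          ((g : GL (Fin 2) K) : Matrix (Fin 2) (Fin 2) K) * X * (((g : GL (Fin 2) K) : Matrix (Fin 2) (Fin 2) K))⁻¹ =
            a • (1 : Matrix (Fin 2) (Fin 2) K) + b • Y i := by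
  -- `(StdForm.antidiagonal 2).over K = (0 1; 1 0)` (★ `Rogawski1990.stdForm_antidiagonal_two_over_eq`, re-derived inline to keep the import closure light)
  obtain rfl : J = !![(0 : K), 1; 1, 0] := hJ.trans (by ext i j; fin_cases i <;> fin_cases j <;> simp [StdForm.over, StdForm.antidiagonal_J_apply, Fin.rev])
  -- the index set: (non-square class representative, non-zero class representative)
  set S : Finset (F × F) := (R.filter fun r => ∀ f : F, r ≠ f ^ 2) ×ˢ (R.filter fun c => c ≠ 0) with hS
  have hmemS : ∀ p : ↥S, (∀ f : F, p.1.1 ≠ f ^ 2) ∧ p.1.2 ≠ 0 := fun p => by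
    obtain ⟨hp1, hp2⟩ := Finset.mem_product.1 p.2
    exact ⟨(Finset.mem_filter.1 hp1).2, (Finset.mem_filter.1 hp2).2⟩
  refine ⟨S.card, fun i => !![(0 : K), ι ((S.equivFin.symm i).1.1 / (S.equivFin.symm i).1.2) * α; ι (S.equivFin.symm i).1.2 * α⁻¹, 0],
    fun i => ⟨rep_mem_lieU ι σ hσ hσι hα _ _, ?_, ?_⟩, fun X hX hreg hell => ?_⟩
  · obtain ⟨hr, hc⟩ := hmemS (S.equivFin.symm i)
    have hr0 : (S.equivFin.symm i).1.1 ≠ 0 := fun h => hr 0 (by rw [h]; ring)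
    rw [discr_charpoly_rep ι σ hσ hσι hα hα0 h2 _ hc]
    exact mul_ne_zero (by exact_mod_cast (pow_ne_zero 2 h2 : (2 : K) ^ 2 ≠ 0)) ((map_ne_zero ι).2 hr0)
  · obtain ⟨hr, hc⟩ := hmemS (S.equivFin.symm i)
    exact not_isotropic_eigenvector_rep ι σ hσι hfix hα hα0 hr hc
  · obtain ⟨r, hrR, c, hcR, hr, hc0, u, a, b, ha, hb, heq⟩ := exists_unitary_conj_eq_normalForm ι σ hσ hσι hfix hα hα0 h2 R hR hX hreg hell
    have hmem : (r, c) ∈ S := by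
      rw [hS, Finset.mem_product, Finset.mem_filter, Finset.mem_filter]
      exact ⟨⟨hrR, hr⟩, hcR, hc0⟩
    refine ⟨S.equivFin ⟨(r, c), hmem⟩, u, a, b, ha, hb, ?_⟩
    simpa only [Equiv.symm_apply_apply] using heq

end Algebra

end Summit.HodgeConjecture.HodgeConjecture.Cruxes.H413.K2E3U2CompactCartanClasses

end
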